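import Mathlib
import HarnessLib
import Summits.RiemannHypothesis.RiemannHypothesis.Theses.WeilParity
import Summits.RiemannHypothesis.RiemannHypothesis.Theorems.WeilParityEvenWinsBeyondArchStubOnePrimeWindow

/-!
# Route WeilParity, item 18084 `OnePrimeWindowSimpleEven` — the one-prime parity theorem

`OnePrimeWindowSimpleEven` (crux #5 of route WeilParity, piece P1 of `EvenWinsBeyondArch`): on every
window `(log 2)/2 < a ≤ (log 3)/2` — exactly one prime power, `2`, enters Weil's windowed form — the
bottom of the form is simple, isolated and even (`WeilWindowSimpleEven a`).  RH-FREE.  It is the landed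
`Theorems.stub_onePrimeWindowSimpleEven` (stub 1 of line `split` of the parent crux `EvenWinsBeyondArch`,
composed from the sister crux `GroundStateSimpleEven`'s eight certified cell bounds): four certified cells
`[11/32,2/5],[2/5,23/50],[23/50,51/100],[51/100,(log 3)/2]`, each an even Rayleigh–Ritz upper bound at the
left end (polynomial × indicator trial in the Markov form) below an odd-sector MARGIN certificate at the
right end (Stage-C `WeilCert3` odd block with lowered Bessel coefficient), composed by the cell transfer
`weilWindowSimpleEven_on_cell_of_le`.
-/

namespace Summit.RiemannHypothesis.RiemannHypothesis.Theorems.WeilParity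

/-- **Item stmt-RiemannHypothesis-18084** (`OnePrimeWindowSimpleEven`). [cite: ConnesSuijlekom2025, Thm. 6.1 (hypothesis); Yoshida1992, Thm 1 (method); certificate in-tree] -/
theorem onePrimeWindowSimpleEven_proof :
    Summit.RiemannHypothesis.RiemannHypothesis.Theses.WeilParity.OnePrimeWindowSimpleEven :=
  Summit.RiemannHypothesis.RiemannHypothesis.Theorems.stub_onePrimeWindowSimpleEven

end Summit.RiemannHypothesis.RiemannHypothesis.Theorems.WeilParity
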